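import Mathlib.Analysis.Complex.Basic
import Summits.ValiantsHypothesis.ValiantsHypothesis.Theorems.LiftNullstellensatzLiftWidthPerFourClaimF

/-!
# Route LiftNullstellensatz — `LiftWidthPerFour` (stmt-ValiantsHypothesis-5922): stub `stub_claimF` by name

The registered stub `stub_claimF` of the line `Cruxes/LiftWidthPerFour/Lines/outer_layers.lean`
(Claim F over `ℂ`: linear spaces of `4 × 4` complex matrices of dimension `≥ 11` on which the
permanent vanishes identically are row or column spaces), obtained by specialising the landed
general-field theorem `linearSpace_perm4_row_or_col` (file `…ClaimF.lean`) to `K = ℂ`.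
No new definitions.  VP ≠ VNP is not moved by this file.
-/

namespace Summit.ValiantsHypothesis.LiftNullstellensatz

/-- **Stub F of line `outer_layers`** (Claim F over `ℂ`): every linear subspace `W ≤ M_4(ℂ)` with
`dim W ≥ 11` and `per|_W ≡ 0` lies in `{row i₀ = 0}` or in `{column j₀ = 0}`.
[cite: GutermanMeshulamSpiridonov2023, Thm 1.7 (dim 12; method)] -/
theorem stub_claimF :
    ∀ W : Submodule ℂ (Matrix (Fin 4) (Fin 4) ℂ), 11 ≤ Module.finrank ℂ W →
      (∀ A ∈ W, A.permanent = 0) →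
      (∃ i₀ : Fin 4, ∀ A ∈ W, ∀ j, A i₀ j = 0) ∨ (∃ j₀ : Fin 4, ∀ A ∈ W, ∀ i, A i j₀ = 0) :=
  fun W hW hper => linearSpace_perm4_row_or_col (K := ℂ) two_ne_zero W hW hper

end Summit.ValiantsHypothesis.LiftNullstellensatz
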